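import Mathlib

/-!
# Gladkov's three-point margin under series and parallel composition (hub-free, cell level)

For a finite graph with independent bond percolation and vertices `a, b, x` write
`θ = P(a~b)`, `π_a = P(a~x)`, `π_b = P(b~x)`, `τ = P(a~b~x)` and
`M := π_a π_b − τ²/(2θ)` (so `M ≥ 0` is Gladkov's inequality `P(abx)² ≤ 2 P(ab)P(ax)P(bx)`,
arXiv:2408.08457 Thm 6.1 with the planar constant `2`).  In terms of the partition of `{a,b,x}`:
`τ = P(abx)`, `α = P(ax|b)`, `β = P(bx|a)`, `γ = P(ab|x)`, so `π_a = τ+α`, `π_b = τ+β`, `θ = τ+γ`.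

If `Q` is ANY two-terminal graph glued to `P ∋ x` in parallel at `a, b` (edge-disjoint, sharing only
`a, b`), with `s = P(a ~_Q b)`, then the composite has `π_a' = π_a + sβ`, `π_b' = π_b + sα`,
`τ' = τ + s(α+β)`, `θ' = θ + s(1−θ)`, and the margin satisfies the **parallel step**
`M' ≥ (1−s)·M + s(τ²/2 + τ(α+β) + (α²+β²)/2) + s²αβ ≥ (1−s)·M`
(prim-ineq-prove-2 MEMO-24 §6: germ of the composition conjecture E for the parallel skeleton).
The series step is the identity `M(P∘Q) = θ_Q · M(P)` and needs no lemma.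
These are pure real-arithmetic statements about the cells; this file proves the parallel step.
-/

namespace Summit.CriticalPhenomena.PercolationContinuityZ3.Theorems

namespace GZGladkovSP

/-- Joint convexity of `u²/v` in the two-point form used below:
`(u₁+u₂)²/(v₁+v₂) ≤ u₁²/v₁ + u₂²/v₂` for `v₁, v₂ > 0`. -/
theorem sq_add_div_le {u₁ u₂ v₁ v₂ : ℝ} (hv₁ : 0 < v₁) (hv₂ : 0 < v₂) :
    (u₁ + u₂) ^ 2 / (v₁ + v₂) ≤ u₁ ^ 2 / v₁ + u₂ ^ 2 / v₂ := by
  rw [div_add_div _ _ hv₁.ne' hv₂.ne', div_le_div_iff₀ (by linarith) (by positivity)]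
  nlinarith [sq_nonneg (u₁ * v₂ - u₂ * v₁), mul_pos hv₁ hv₂]

/-- **Parallel step for Gladkov's margin (cell level).**  With `τ, α, β, γ ≥ 0`,
`τ + α + β + γ ≤ 1`, `θ = τ + γ > 0` and `s ∈ [0,1]` (the connection probability of the parallel
piece): `(1−s)·M ≤ M'` where `M = (τ+α)(τ+β) − τ²/(2θ)` and
`M' = (τ+α+sβ)(τ+β+sα) − (τ+s(α+β))²/(2(θ + s(1−θ)))`, with the explicit slack
`s(τ²/2 + τ(α+β) + (α²+β²)/2) + s²αβ`. -/
theorem margin_parallel_step {τ α β γ s : ℝ} (_hτ : 0 ≤ τ) (hα : 0 ≤ α) (hβ : 0 ≤ β)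
    (_hγ : 0 ≤ γ) (hsum : τ + α + β + γ ≤ 1) (hs0 : 0 ≤ s) (hs1 : s ≤ 1) (hθ : 0 < τ + γ) :
    (1 - s) * ((τ + α) * (τ + β) - τ ^ 2 / (2 * (τ + γ)))
        + (s * (τ ^ 2 / 2 + τ * (α + β) + (α ^ 2 + β ^ 2) / 2) + s ^ 2 * (α * β)) ≤
      (τ + α + s * β) * (τ + β + s * α)
        - (τ + s * (α + β)) ^ 2 / (2 * ((τ + γ) + s * (1 - (τ + γ)))) := by
  set θ := τ + γ with hθdef
  have hθ1 : θ ≤ 1 := by rw [hθdef]; linarith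
  have hθs : 0 < θ + s * (1 - θ) := by nlinarith
  -- convexity of u²/v along the segment:  (τ + s D)² / (θ + s(1-θ)) ≤ (1-s) τ²/θ + s (τ+D)²
  have key : (τ + s * (α + β)) ^ 2 / (2 * (θ + s * (1 - θ))) ≤
      (1 - s) * (τ ^ 2 / (2 * θ)) + s * ((τ + (α + β)) ^ 2 / 2) := by
    rcases eq_or_lt_of_le hs0 with hs | hs
    · -- s = 0
      rw [← hs]; simp
    rcases eq_or_lt_of_le hs1 with hs' | hs'
    · -- s = 1
      rw [hs']; ring_nf; nlinarith [sq_nonneg (τ + (α+β))]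
    have h1 : 0 < 1 - s := by linarith
    have hv₁ : 0 < 2 * ((1 - s) * θ) := by positivity
    have hv₂ : 0 < 2 * (s * 1) := by positivity
    have hc := sq_add_div_le (u₁ := (1 - s) * τ) (u₂ := s * (τ + (α + β))) hv₁ hv₂
    have e1 : (1 - s) * τ + s * (τ + (α + β)) = τ + s * (α + β) := by ring
    have e2 : 2 * ((1 - s) * θ) + 2 * (s * 1) = 2 * (θ + s * (1 - θ)) := by ring
    rw [e1, e2] at hc
    have e3 : ((1 - s) * τ) ^ 2 / (2 * ((1 - s) * θ)) = (1 - s) * (τ ^ 2 / (2 * θ)) := by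
      field_simp
    have e4 : (s * (τ + (α + β))) ^ 2 / (2 * (s * 1)) = s * ((τ + (α + β)) ^ 2 / 2) := by
      field_simp
    rw [e3, e4] at hc
    exact hc
  -- the remaining polynomial inequality is an identity plus squares
  nlinarith [key, mul_nonneg hs0 hα, mul_nonneg hs0 hβ, mul_nonneg hα hβ, sq_nonneg τ,
    mul_nonneg _hτ hα, mul_nonneg _hτ hβ, mul_nonneg (mul_nonneg hs0 hs0) (mul_nonneg hα hβ)]

/-- Corollary: the parallel step preserves nonnegativity of the margin:
`M(P) ≥ 0 ⟹ M(P ∥ Q) ≥ 0` (indeed `M(P∥Q) ≥ (1−s) M(P)`). -/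
theorem margin_parallel_nonneg {τ α β γ s : ℝ} (hτ : 0 ≤ τ) (hα : 0 ≤ α) (hβ : 0 ≤ β)
    (hγ : 0 ≤ γ) (hsum : τ + α + β + γ ≤ 1) (hs0 : 0 ≤ s) (hs1 : s ≤ 1) (hθ : 0 < τ + γ)
    (hM : 0 ≤ (τ + α) * (τ + β) - τ ^ 2 / (2 * (τ + γ))) :
    0 ≤ (τ + α + s * β) * (τ + β + s * α)
        - (τ + s * (α + β)) ^ 2 / (2 * ((τ + γ) + s * (1 - (τ + γ)))) := by
  have h := margin_parallel_step hτ hα hβ hγ hsum hs0 hs1 hθ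
  have hslack : 0 ≤ s * (τ ^ 2 / 2 + τ * (α + β) + (α ^ 2 + β ^ 2) / 2) + s ^ 2 * (α * β) := by
    positivity
  have h1 : 0 ≤ 1 - s := by linarith
  nlinarith [mul_nonneg h1 hM]

/-- **Series step for Gladkov's margin (cell level; an identity).**  If `x ∈ P = (a,m)` with cells
`τ, α, β, γ` (w.r.t. `a, m, x`) and `Q = (m, b)` is any piece with connection probability `q > 0`,
the series composite has `π_a' = τ+α`, `π_b' = q(τ+β)`, `τ' = qτ`, `θ' = q(τ+γ)`, and
`M' = q · M`. -/
theorem margin_series_step {τ α β γ q : ℝ} (hθ : 0 < τ + γ) (hq : 0 < q) :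
    (τ + α) * (q * (τ + β)) - (q * τ) ^ 2 / (2 * (q * (τ + γ))) =
      q * ((τ + α) * (τ + β) - τ ^ 2 / (2 * (τ + γ))) := by
  field_simp

end GZGladkovSP

end Summit.CriticalPhenomena.PercolationContinuityZ3.Theorems
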